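import Summits.KontsevichZagierPeriods.KontsevichZagierPeriods.Theses.IsogenyCertificates
import Literature.NumberTheory.Transcendental.KZCalculus
import Literature.NumberTheory.EllipticCurves.RealPeriodProofs
import Summits.KontsevichZagierPeriods.KontsevichZagierPeriods.Theorems.EffectiveXMapChains.Negative.PeriodRep
import Literature.AlgebraicGeometry.RealAlgebraic.SemialgebraicOverRealAlgebraicField
import Mathlib.FieldTheory.AlgebraicClosure

/-!
# `AlgebraicModuliRealPeriodCell` (stmt-KontsevichZagierPeriods-18265, route IsogenyCertificates) —
line `Sketch`, foundation: the period representations with REAL-ALGEBRAIC moduli (stub S)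

The crux is the parent crux `XMapKernel`'s proved real-period cell
(`XMapKernelCells.realPeriodCellKernel_relations`) one field up: moduli `α, β` and scalars `a` in
`ℚ̄ ∩ ℝ` instead of `ℤ` / `ℚ`. This file is the port of the `ℚ`-line's period-representation
basics (`EffectiveXMapChains/Negative/PeriodRep.lean`, `XMapKernelStubClassReduction.exists_periodPair`)
to real coefficients, with the one new ingredient of the line: a set or function that is
semialgebraic over the field `algebraicClosure ℚ ℝ` of real algebraic numbers is `ℚ`-semialgebraic
(`IsSemialgebraic.rat_of_isAlgebraic`, Kontsevich–Zagier §1.1 / Bochnak–Coste–Roy 2.2.1).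

* `isSemialgebraic_domain`, `isSemialgebraicFunOn_integrand` — `{x³+αx+β > 0} ⊆ ℝ¹` and
  `a/√(x³+αx+β)` on it are `ℚ`-semialgebraic for real algebraic `α, β, a`;
* `integrableOn_rep`, `setIntegral_rep`, `realPeriod_pos`, `value_eq` — integrability and the value
  `a · Ω(E_{α,β})`, `Ω = realPeriod ⟨0,0,0,α,β⟩ = ∫_{P>0} dx/√P > 0`, for ALL real nonsingular `(α, β)`;
* `stub_algSectorRepsExist` — **stub S of the line**: the representation `[{P>0}, a/√P]` exists;
* `exists_periodPair` — the real period lattice with `g₂ = −4α`, `g₃ = −4β` and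
  `∫_{P>0} dx/√P = n · Ω₀(Λ)`, `n ∈ {1, 2}`.

No definitions (the short model is written inline as `(⟨0, 0, 0, α, β⟩ : WeierstrassCurve ℝ)`); no
named facts are introduced.

References: Kontsevich–Zagier, *Periods* (2001), §1.1; Bochnak–Coste–Roy, *Real Algebraic Geometry*
(1998), Thm. 2.2.1; Cremona, *Algorithms for Modular Elliptic Curves* (1997), §3.7; Silverman,
*The Arithmetic of Elliptic Curves* (2009), VI.5.1, C.16.
-/

noncomputable section

namespace Summit.KontsevichZagierPeriods.IsogenyCertificates.AlgRealPeriodCell.PeriodRep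

open Set MeasureTheory Polynomial
open Literature.NumberTheory.Transcendental
open Summit.KontsevichZagierPeriods.IsogenyCertificates (EffectiveXMapChainsNegative.sqrt_four_mul
  EffectiveXMapChainsNegative.eq_div_sqrt_iff)
open Literature.ModelTheory.ExponentialFields (IsSemialgebraic isSemialgebraic_setOf_eval_pos
  isSemialgebraic_setOf_eval_eq_zero isSemialgebraic_setOf_eval_nonneg)

/-! ## §1 The field of real algebraic numbers as coefficient field -/

/-- Every element of `algebraicClosure ℚ ℝ` maps to a real algebraic number (tautology phrased for
`IsSemialgebraic.rat_of_isAlgebraic`). [folklore] -/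
theorem algebraicClosure_isAlgebraic :
    ∀ c : ↥(algebraicClosure ℚ ℝ), IsAlgebraic ℚ (algebraMap (↥(algebraicClosure ℚ ℝ)) ℝ c) :=
  fun c => mem_algebraicClosure_iff.1 c.2

/-- `algebraMap (algebraicClosure ℚ ℝ) ℝ` is the inclusion. [folklore] -/
@[simp] theorem algebraMap_algebraicClosure_apply (c : ↥(algebraicClosure ℚ ℝ)) :
    algebraMap (↥(algebraicClosure ℚ ℝ)) ℝ c = (c : ℝ) := rfl

/-- A real polynomial with algebraic coefficients lifts to `(algebraicClosure ℚ ℝ)[X]`. [folklore] -/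
theorem exists_map_eq_of_coeff_isAlgebraic (f : ℝ[X]) (hf : ∀ n, IsAlgebraic ℚ (f.coeff n)) :
    ∃ F : (↥(algebraicClosure ℚ ℝ))[X], F.map (algebraMap (↥(algebraicClosure ℚ ℝ)) ℝ) = f := by
  have hl : f ∈ Polynomial.lifts (algebraMap (↥(algebraicClosure ℚ ℝ)) ℝ) := by
    rw [Polynomial.lifts_iff_coeff_lifts]
    intro n
    exact ⟨⟨f.coeff n, mem_algebraicClosure_iff.2 (hf n)⟩, rfl⟩
  obtain ⟨F, hF, -⟩ := Polynomial.exists_degree_eq_of_mem_lifts hl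
  exact ⟨F, hF⟩

/-- **Sign / zero conditions on a real polynomial in one coordinate with algebraic coefficients are
`ℚ`-semialgebraic**: `{x ∈ ℝⁿ | R (f (x i))}` for `R ∈ {· = 0, 0 < ·, 0 ≤ ·}`.
[cite: BochnakCosteRoy1998, Thm. 2.2.1] -/
theorem isSemialgebraic_setOf_eval_coord {n : ℕ} (i : Fin n) (f : ℝ[X])
    (hf : ∀ m, IsAlgebraic ℚ (f.coeff m)) :
    IsSemialgebraic ℚ {x : Fin n → ℝ | 0 < f.eval (x i)} ∧
      IsSemialgebraic ℚ {x : Fin n → ℝ | f.eval (x i) = 0} ∧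
      IsSemialgebraic ℚ {x : Fin n → ℝ | 0 ≤ f.eval (x i)} := by
  obtain ⟨F, hF⟩ := exists_map_eq_of_coeff_isAlgebraic f hf
  set P : MvPolynomial (Fin n) ↥(algebraicClosure ℚ ℝ) := Polynomial.aeval (MvPolynomial.X i) F
  have hP : ∀ x : Fin n → ℝ, MvPolynomial.aeval x P = f.eval (x i) := by
    intro x
    rw [← hF, Polynomial.eval_map, ← Polynomial.aeval_def]
    simp only [P, ← Polynomial.aeval_algHom_apply, MvPolynomial.aeval_X]
  refine ⟨?_, ?_, ?_⟩
  · have h := (isSemialgebraic_setOf_eval_pos (R := ℝ) P).rat_of_isAlgebraic algebraicClosure_isAlgebraic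
    simpa only [hP] using h
  · have h := (isSemialgebraic_setOf_eval_eq_zero (R := ℝ) P).rat_of_isAlgebraic
      algebraicClosure_isAlgebraic
    simpa only [hP] using h
  · have h := (isSemialgebraic_setOf_eval_nonneg (R := ℝ) P).rat_of_isAlgebraic
      algebraicClosure_isAlgebraic
    simpa only [hP] using h

/-! ## §2 The short model `y² = x³ + αx + β` over `ℝ` (written inline) -/

/-- The 2-torsion polynomial of `y² = x³ + αx + β` is `ψ = 4(x³ + αx + β)`. [folklore] -/
theorem curve_ψ (α β t : ℝ) :
    (⟨0, 0, 0, α, β⟩ : WeierstrassCurve ℝ).twoTorsionPolynomial.toPoly.eval t =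
      4 * (t ^ 3 + α * t + β) := by
  simp only [WeierstrassCurve.twoTorsionPolynomial, Cubic.toPoly, WeierstrassCurve.b₂,
    WeierstrassCurve.b₄, WeierstrassCurve.b₆, eval_add, eval_mul, eval_C, eval_pow, eval_X]
  ring

/-- The discriminant of `y² = x³ + αx + β` is `−16(4α³ + 27β²)`. [folklore] -/
theorem curve_Δ (α β : ℝ) :
    (⟨0, 0, 0, α, β⟩ : WeierstrassCurve ℝ).Δ = -16 * (4 * α ^ 3 + 27 * β ^ 2) := by
  simp only [WeierstrassCurve.Δ, WeierstrassCurve.b₂, WeierstrassCurve.b₄, WeierstrassCurve.b₆,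
    WeierstrassCurve.b₈]
  ring

/-- `4α³ + 27β² ≠ 0` makes `y² = x³ + αx + β` an elliptic curve over `ℝ`. [folklore] -/
theorem curve_isElliptic {α β : ℝ} (h : 4 * α ^ 3 + 27 * β ^ 2 ≠ 0) :
    (⟨0, 0, 0, α, β⟩ : WeierstrassCurve ℝ).IsElliptic := by
  rw [WeierstrassCurve.isElliptic_iff, curve_Δ, isUnit_iff_ne_zero]
  exact mul_ne_zero (by norm_num) h

/-- `c₄ = −48α` for the short model. [folklore] -/
theorem curve_c₄ (α β : ℝ) : (⟨0, 0, 0, α, β⟩ : WeierstrassCurve ℝ).c₄ = -48 * α := by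
  simp only [WeierstrassCurve.c₄, WeierstrassCurve.b₂, WeierstrassCurve.b₄]
  ring

/-- `c₆ = −864β` for the short model. [folklore] -/
theorem curve_c₆ (α β : ℝ) : (⟨0, 0, 0, α, β⟩ : WeierstrassCurve ℝ).c₆ = -864 * β := by
  simp only [WeierstrassCurve.c₆, WeierstrassCurve.b₂, WeierstrassCurve.b₄, WeierstrassCurve.b₆]
  ring

/-- The 2-torsion set `{ψ > 0}` of `y² = x³ + αx + β` is `{x³ + αx + β > 0}`. [folklore] -/
theorem curve_twoTorsionSet (α β : ℝ) :
    (⟨0, 0, 0, α, β⟩ : WeierstrassCurve ℝ).twoTorsionSet = {t | 0 < t ^ 3 + α * t + β} := by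
  ext t
  rw [WeierstrassCurve.mem_twoTorsionSet_iff, curve_ψ, mem_setOf_eq]
  exact mul_pos_iff_of_pos_left (by norm_num)

/-- `a/√P = 2a·(√ψ)⁻¹` with `ψ = 4P` (also at the junk value `√P = 0`). [folklore] -/
theorem div_sqrt_eq (a t α β : ℝ) :
    a / Real.sqrt (t ^ 3 + α * t + β) =
      2 * a * (Real.sqrt ((⟨0, 0, 0, α, β⟩ : WeierstrassCurve ℝ).twoTorsionPolynomial.toPoly.eval t))⁻¹ := by
  rw [curve_ψ, EffectiveXMapChainsNegative.sqrt_four_mul]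
  by_cases hu : Real.sqrt (t ^ 3 + α * t + β) = 0
  · simp [hu]
  · field_simp

/-! ## §3 Integrability, semialgebraicity, the representation, its value -/

/-- Integrability of `a/√P` on `{P > 0} ⊆ ℝ` for a nonsingular real cubic (from the tree's
real-period file). [cite: CremonaAlgorithms1997, §3.7] -/
theorem integrableOn_real {α β : ℝ} (h : 4 * α ^ 3 + 27 * β ^ 2 ≠ 0) (a : ℝ) :
    IntegrableOn (fun t : ℝ => a / Real.sqrt (t ^ 3 + α * t + β)) {t | 0 < t ^ 3 + α * t + β} := by
  haveI := curve_isElliptic h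
  have hint := (⟨0, 0, 0, α, β⟩ : WeierstrassCurve ℝ).integrableOn_inv_sqrt_twoTorsionPolynomial'
  rw [curve_twoTorsionSet] at hint
  have heq : (fun t : ℝ => a / Real.sqrt (t ^ 3 + α * t + β)) = fun t =>
      2 * a * (Real.sqrt ((⟨0, 0, 0, α, β⟩ : WeierstrassCurve ℝ).twoTorsionPolynomial.toPoly.eval t))⁻¹ := by
    funext t; exact div_sqrt_eq a t α β
  rw [heq]
  exact hint.const_mul (2 * a)

/-- The same on `ℝ¹ = Fin 1 → ℝ` (transport along `MeasurableEquiv.funUnique`).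
[cite: CremonaAlgorithms1997, §3.7] -/
theorem integrableOn_rep {α β : ℝ} (h : 4 * α ^ 3 + 27 * β ^ 2 ≠ 0) (a : ℝ) :
    IntegrableOn (fun x : Fin 1 → ℝ => a / Real.sqrt (x 0 ^ 3 + α * x 0 + β))
      {x | 0 < x 0 ^ 3 + α * x 0 + β} := by
  have he := MeasureTheory.volume_preserving_funUnique (Fin 1) ℝ
  exact (he.integrableOn_comp_preimage (MeasurableEquiv.measurableEmbedding _)).mpr
    (integrableOn_real h a)

/-- The cubic `X³ + αX + β ∈ ℝ[X]` has algebraic coefficients when `α, β` are algebraic. [folklore] -/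
theorem coeff_cubic_isAlgebraic {α β : ℝ} (hα : IsAlgebraic ℚ α) (hβ : IsAlgebraic ℚ β) (m : ℕ) :
    IsAlgebraic ℚ ((X ^ 3 + C α * X + C β : ℝ[X]).coeff m) := by
  simp only [coeff_add, coeff_C_mul, coeff_X_pow, coeff_X, coeff_C]
  refine ((?_ : IsAlgebraic ℚ _).add (hα.mul ?_)).add ?_
  · split_ifs <;> simp [isAlgebraic_one, isAlgebraic_zero]
  · split_ifs <;> simp [isAlgebraic_one, isAlgebraic_zero]
  · split_ifs <;> simp [hβ, isAlgebraic_zero]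

/-- The domain `{x | 0 < x₀³ + αx₀ + β} ⊆ ℝ¹` is `ℚ`-semialgebraic for real algebraic `α, β`.
[cite: KontsevichZagier2001, §1.1] -/
theorem isSemialgebraic_domain {α β : ℝ} (hα : IsAlgebraic ℚ α) (hβ : IsAlgebraic ℚ β) :
    IsSemialgebraic ℚ {x : Fin 1 → ℝ | 0 < x 0 ^ 3 + α * x 0 + β} := by
  have h := (isSemialgebraic_setOf_eval_coord (0 : Fin 1) (X ^ 3 + C α * X + C β)
    (coeff_cubic_isAlgebraic hα hβ)).1
  convert h using 2 with x
  simp [eval_add, eval_mul, eval_pow, eval_X, eval_C]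

/-- The integrand `a/√(x₀³ + αx₀ + β)` is a `ℚ`-semialgebraic function on `{P > 0}` for real
algebraic `α, β, a`: its graph is `{P(z₀) > 0, z₁²P(z₀) − a² = 0, a z₁ ≥ 0}`, a Boolean combination
of sign conditions on polynomials with real algebraic coefficients. [cite: KontsevichZagier2001, §1.1] -/
theorem isSemialgebraicFunOn_integrand {α β a : ℝ} (hα : IsAlgebraic ℚ α) (hβ : IsAlgebraic ℚ β)
    (ha : IsAlgebraic ℚ a) :
    IsSemialgebraicFunOn ℚ {x : Fin 1 → ℝ | 0 < x 0 ^ 3 + α * x 0 + β}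
      (fun x => a / Real.sqrt (x 0 ^ 3 + α * x 0 + β)) := by
  rw [isSemialgebraicFunOn_iff]
  -- the three sign conditions, as polynomials over `K = algebraicClosure ℚ ℝ` in `z₀, z₁`
  set K := ↥(algebraicClosure ℚ ℝ)
  have hαK : α ∈ algebraicClosure ℚ ℝ := mem_algebraicClosure_iff.2 hα
  have hβK : β ∈ algebraicClosure ℚ ℝ := mem_algebraicClosure_iff.2 hβ
  have haK : a ∈ algebraicClosure ℚ ℝ := mem_algebraicClosure_iff.2 ha
  set cub : MvPolynomial (Fin 2) K :=
    MvPolynomial.X 0 ^ 3 + MvPolynomial.C (⟨α, hαK⟩ : K) * MvPolynomial.X 0 + MvPolynomial.C (⟨β, hβK⟩ : K)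
  have hcub : ∀ z : Fin 2 → ℝ, MvPolynomial.aeval z cub = z 0 ^ 3 + α * z 0 + β := by
    intro z
    simp only [cub, map_add, map_mul, map_pow, MvPolynomial.aeval_X, MvPolynomial.aeval_C]
    rfl
  have h1 := (isSemialgebraic_setOf_eval_pos (R := ℝ) cub).rat_of_isAlgebraic
    algebraicClosure_isAlgebraic
  have h2 := (isSemialgebraic_setOf_eval_eq_zero (R := ℝ)
    (MvPolynomial.X 1 ^ 2 * cub - MvPolynomial.C ((⟨a, haK⟩ : K) ^ 2))).rat_of_isAlgebraic
    algebraicClosure_isAlgebraic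
  have h3 := (isSemialgebraic_setOf_eval_nonneg (R := ℝ)
    (MvPolynomial.C (⟨a, haK⟩ : K) * MvPolynomial.X (1 : Fin 2))).rat_of_isAlgebraic
    algebraicClosure_isAlgebraic
  convert h1.inter (h2.inter h3) using 1
  ext z
  simp only [mem_setOf_eq, mem_inter_iff, map_sub, map_mul, map_pow, MvPolynomial.aeval_X,
    MvPolynomial.aeval_C, hcub, algebraMap_algebraicClosure_apply]
  have e0 : Fin.init z 0 = z 0 := rfl
  have e1 : z (Fin.last 1) = z 1 := rfl
  rw [e0, e1]
  constructor
  · rintro ⟨hP, hy⟩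
    exact ⟨hP, by simpa using (EffectiveXMapChainsNegative.eq_div_sqrt_iff hP).mp hy⟩
  · rintro ⟨hP, hy⟩
    exact ⟨hP, (EffectiveXMapChainsNegative.eq_div_sqrt_iff hP).mpr (by simpa using hy)⟩

/-- **Stub S of line `Sketch` — the sector representations exist.** For real algebraic `α, β, a`
with `4α³ + 27β² ≠ 0`, `[{x³+αx+β > 0}, a/√(x³+αx+β)]` is a KZ integral representation of
dimension `1` (semialgebraic over `ℚ̄ ∩ ℝ`, hence over `ℚ`; absolutely convergent).
[cite: KontsevichZagier2001, §1.1] -/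
theorem stub_algSectorRepsExist : ∀ (α β a : ℝ), IsAlgebraic ℚ α → IsAlgebraic ℚ β → IsAlgebraic ℚ a → 4 * α ^ 3 + 27 * β ^ 2 ≠ 0 → ∃ r : Literature.NumberTheory.Transcendental.KZ.IntegralRep 1, r.domain = {x | 0 < x 0 ^ 3 + α * x 0 + β} ∧ r.integrand = fun x => a / Real.sqrt (x 0 ^ 3 + α * x 0 + β) :=
  fun _ _ a hα hβ ha h =>
    ⟨{ domain := _, integrand := _, isSemialgebraic_domain := isSemialgebraic_domain hα hβ,
       isSemialgebraicFunOn_integrand := isSemialgebraicFunOn_integrand hα hβ ha,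
       integrableOn := integrableOn_rep h a }, rfl, rfl⟩

/-- `∫_{x ∈ ℝ¹, P(x₀) > 0} a/√P(x₀) = a · Ω(E_{α,β})` (`Ω = realPeriod`, which integrates over all of
`{ψ > 0}`). [cite: CremonaAlgorithms1997, §3.7] -/
theorem setIntegral_rep (α β a : ℝ) :
    ∫ x in {x : Fin 1 → ℝ | 0 < x 0 ^ 3 + α * x 0 + β}, a / Real.sqrt (x 0 ^ 3 + α * x 0 + β) =
      a * (⟨0, 0, 0, α, β⟩ : WeierstrassCurve ℝ).realPeriod := by
  have he := MeasureTheory.volume_preserving_funUnique (Fin 1) ℝ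
  have h1 := he.setIntegral_preimage_emb (MeasurableEquiv.measurableEmbedding _)
    (fun t : ℝ => a / Real.sqrt (t ^ 3 + α * t + β)) {t | 0 < t ^ 3 + α * t + β}
  refine h1.trans ?_
  have hmeas : MeasurableSet {t : ℝ | 0 < t ^ 3 + α * t + β} := by
    rw [← curve_twoTorsionSet]
    exact (⟨0, 0, 0, α, β⟩ : WeierstrassCurve ℝ).measurableSet_twoTorsionSet
  rw [setIntegral_congr_fun hmeas (fun t _ => div_sqrt_eq a t α β), integral_const_mul,
    WeierstrassCurve.realPeriod, curve_twoTorsionSet]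
  ring

/-- `Ω(E) > 0` for a nonsingular real cubic (the tree's `realPeriod_pos'`). [folklore] -/
theorem realPeriod_pos {α β : ℝ} (h : 4 * α ^ 3 + 27 * β ^ 2 ≠ 0) :
    0 < (⟨0, 0, 0, α, β⟩ : WeierstrassCurve ℝ).realPeriod := by
  haveI := curve_isElliptic h
  exact (⟨0, 0, 0, α, β⟩ : WeierstrassCurve ℝ).realPeriod_pos'

/-- The full real period `∫_{P>0} dx/√P` is positive for a nonsingular real cubic. [folklore] -/
theorem period_pos {α β : ℝ} (h : 4 * α ^ 3 + 27 * β ^ 2 ≠ 0) :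
    0 < ∫ x in {x : Fin 1 → ℝ | 0 < x 0 ^ 3 + α * x 0 + β}, 1 / Real.sqrt (x 0 ^ 3 + α * x 0 + β) := by
  rw [setIntegral_rep α β 1, one_mul]
  exact realPeriod_pos h

/-- Any representation with the sector's domain and integrand-on-domain `a/√P` has value
`a · ∫_{P>0} dx/√P`. [folklore] -/
theorem value_eq {α β a : ℝ} (r : KZ.IntegralRep 1)
    (h1 : r.domain = {x | 0 < x 0 ^ 3 + α * x 0 + β})
    (h2 : EqOn r.integrand (fun x => a / Real.sqrt (x 0 ^ 3 + α * x 0 + β)) r.domain) :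
    r.value = a * ∫ x in {x : Fin 1 → ℝ | 0 < x 0 ^ 3 + α * x 0 + β},
      1 / Real.sqrt (x 0 ^ 3 + α * x 0 + β) := by
  unfold KZ.IntegralRep.value
  rw [setIntegral_congr_fun (KZ.IntegralRep.measurableSet_domain_holds r) h2, h1,
    setIntegral_rep α β a, setIntegral_rep α β 1, one_mul]

/-- Integrability of `1/√P` on `{P > 0}` inherited from any representation of the sector with a
non-zero scalar (no nonsingularity hypothesis needed). [folklore] -/
theorem integrableOn_of_rep {α β a : ℝ} (r : KZ.IntegralRep 1)
    (hd : r.domain = {x : Fin 1 → ℝ | 0 < x 0 ^ 3 + α * x 0 + β})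
    (hi : EqOn r.integrand (fun x => a / Real.sqrt (x 0 ^ 3 + α * x 0 + β)) r.domain)
    (ha : a ≠ 0) :
    IntegrableOn (fun x : Fin 1 → ℝ => 1 / Real.sqrt (x 0 ^ 3 + α * x 0 + β))
      {x : Fin 1 → ℝ | 0 < x 0 ^ 3 + α * x 0 + β} := by
  have hmeas : MeasurableSet {x : Fin 1 → ℝ | 0 < x 0 ^ 3 + α * x 0 + β} :=
    measurableSet_lt measurable_const (by fun_prop)
  have h := r.integrableOn
  rw [hd] at h hi
  have h' : IntegrableOn (fun x : Fin 1 → ℝ => a / Real.sqrt (x 0 ^ 3 + α * x 0 + β))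
      {x : Fin 1 → ℝ | 0 < x 0 ^ 3 + α * x 0 + β} := h.congr_fun hi hmeas
  have h'' : IntegrableOn (fun x : Fin 1 → ℝ => a⁻¹ * (a / Real.sqrt (x 0 ^ 3 + α * x 0 + β)))
      {x : Fin 1 → ℝ | 0 < x 0 ^ 3 + α * x 0 + β} := h'.const_mul a⁻¹
  refine h''.congr_fun (fun x _ => ?_) hmeas
  simp only
  rw [div_eq_mul_one_div, ← mul_assoc, inv_mul_cancel₀ ha, one_mul]

/-! ## §4 The real period lattice -/

/-- **The real period lattice of `y² = x³ + αx + β`** (`4α³ + 27β² ≠ 0`, `α, β ∈ ℝ`): a real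
period pair `L` with `g₂(L) = −4α`, `g₃(L) = −4β` whose least positive real period `Ω₀(L)`
computes the full real period, `∫_{P > 0} dx/√P = n · Ω₀(L)` with `n = numRealComponents ∈ {1, 2}`
(Silverman AEC VI.5.1 + C.16 via the tree's `exists_periodPair_realPeriod_eq_holds`,
`setIntegral_rep`, `isReal_of_g₂_g₃_real`). [cite: SilvermanAEC2009, Thm VI.5.1 and C.16] -/
theorem exists_periodPair {α β : ℝ} (h : 4 * α ^ 3 + 27 * β ^ 2 ≠ 0) :
    ∃ L : PeriodPair, L.g₂ = -4 * (α : ℂ) ∧ L.g₃ = -4 * (β : ℂ) ∧ L.IsReal ∧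
      (∫ x in {x : Fin 1 → ℝ | 0 < x 0 ^ 3 + α * x 0 + β}, 1 / Real.sqrt (x 0 ^ 3 + α * x 0 + β)) =
        (⟨0, 0, 0, α, β⟩ : WeierstrassCurve ℝ).numRealComponents * L.minRealPeriod := by
  haveI := curve_isElliptic h
  obtain ⟨L, h₂, h₃, hΩ⟩ := (⟨0, 0, 0, α, β⟩ : WeierstrassCurve ℝ).exists_periodPair_realPeriod_eq_holds
  have hreal : L.IsReal :=
    PeriodPair.isReal_of_g₂_g₃_real PeriodPair.uniformization_unique_holds
      (by rw [h₂, Complex.ofReal_im]) (by rw [h₃, Complex.ofReal_im])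
  rw [curve_c₄] at h₂
  rw [curve_c₆] at h₃
  refine ⟨L, ?_, ?_, hreal, ?_⟩
  · rw [h₂]; push_cast; ring
  · rw [h₃]; push_cast; ring
  · rw [setIntegral_rep α β 1, one_mul, hΩ, PeriodPair.minRealPeriod_def]

end Summit.KontsevichZagierPeriods.IsogenyCertificates.AlgRealPeriodCell.PeriodRep

end
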